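import Summits.NavierStokesRegularity.TurbBounds.FSU1.Corner
import Summits.NavierStokesRegularity.TurbBounds.FSU1.Mode.M03Defs

/-!
# FS-U1″ mode lemma — MajorH (`TurbBounds/FSU1/Mode/M10MajorH.lean`)

The even majorant `‖H_ρ‖² ≤ PH(ρ)` on `[0,1]` by exact factorial series — `MH.majorH : MajorH`.

Cell-made mathematics of FS-PROOF-DRAFT §3 (pub-turb-sos), kernel-checked; generated from the design compose file
`StageF_compose.check.lean` (96c4b9bf…) by `build_mode_split.py`.  HONEST FRAMING: rigorous bounds for the stated PDE and boundary conditions; no claim about physical turbulence beyond the bound.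
-/

open Real intervalIntegral MeasureTheory Set Finset

namespace Summit.NavierStokesRegularity.TurbBounds.FSU1.Mode

open Summit.NavierStokesRegularity.TurbBounds.SpectralFormFreeSlip
open Summit.NavierStokesRegularity.TurbBounds.FSU1

namespace MH

/-- `c ρ m = ρ^(2m)/(2m+2)!`. -/
noncomputable def c (ρ : ℝ) (m : ℕ) : ℝ := ρ ^ (2 * m) / ((2 * m + 2).factorial : ℝ)

/-- Series term `g ρ s m = c ρ m · (1 − s^(2m+2))`. -/
noncomputable def g (ρ s : ℝ) (m : ℕ) : ℝ := c ρ m * (1 - s ^ (2 * m + 2))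

/-- The integrand `(cosh ρ − cosh ρs)/ρ²`. -/
noncomputable def hf (ρ s : ℝ) : ℝ := (Real.cosh ρ - Real.cosh (ρ * s)) / ρ ^ 2

/-- The series coefficients `c ρ m = ρ^{2m}/(2m+2)!` are non-negative for `ρ ≥ 0`. -/
theorem c_nonneg {ρ : ℝ} (hρ : 0 ≤ ρ) (m : ℕ) : 0 ≤ c ρ m := by
  unfold c; positivity

/-- `c ρ m ≤ 1/(2m+2)!` for `0 ≤ ρ ≤ 1`. -/
theorem c_le {ρ : ℝ} (hρ0 : 0 ≤ ρ) (hρ1 : ρ ≤ 1) (m : ℕ) : c ρ m ≤ 1 / ((2 * m + 2).factorial : ℝ) := by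
  unfold c
  gcongr
  exact pow_le_one₀ hρ0 hρ1

/-- `g ρ s m ≥ 0` for `ρ ≥ 0`, `0 ≤ s ≤ 1`. -/
theorem g_nonneg {ρ s : ℝ} (hρ : 0 ≤ ρ) (hs0 : 0 ≤ s) (hs1 : s ≤ 1) (m : ℕ) : 0 ≤ g ρ s m :=
  mul_nonneg (c_nonneg hρ m) (sub_nonneg.2 (pow_le_one₀ hs0 hs1))

/-- `g ρ s m ≤ c ρ m` for `s ≥ 0`. -/
theorem g_le_c {ρ s : ℝ} (hρ : 0 ≤ ρ) (hs0 : 0 ≤ s) (m : ℕ) : g ρ s m ≤ c ρ m :=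
  mul_le_of_le_one_right (c_nonneg hρ m) (sub_le_self _ (pow_nonneg hs0 _))

/-- The power series of the integrand (shifted by one: the constant terms cancel). -/
theorem hasSum_g {ρ : ℝ} (hρ : ρ ≠ 0) (s : ℝ) : HasSum (g ρ s) (hf ρ s) := by
  set f : ℕ → ℝ := fun n => (ρ ^ (2 * n) / ((2 * n).factorial : ℝ)
      - (ρ * s) ^ (2 * n) / ((2 * n).factorial : ℝ)) / ρ ^ 2 with hfdef
  have h1 : HasSum f ((Real.cosh ρ - Real.cosh (ρ * s)) / ρ ^ 2) :=
    ((Real.hasSum_cosh ρ).sub (Real.hasSum_cosh (ρ * s))).div_const (ρ ^ 2)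
  have h2 := (hasSum_nat_add_iff' 1).mpr h1
  have hf0 : ∑ i ∈ range 1, f i = 0 := by simp [hfdef]
  rw [hf0, sub_zero] at h2
  have e : (fun n => f (n + 1)) = g ρ s := by
    funext n
    simp only [hfdef]
    unfold g c
    have e1 : 2 * (n + 1) = 2 * n + 2 := by ring
    rw [e1, mul_pow, pow_add ρ (2 * n) 2]
    field_simp
  rw [e] at h2
  exact h2

/-- `26!·2^m ≤ (2m+26)!`. -/
theorem fact_ge (m : ℕ) : Nat.factorial 26 * 2 ^ m ≤ Nat.factorial (2 * (m + 12) + 2) := by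
  induction m with
  | zero => simp
  | succ n ih =>
    have e : 2 * (n + 1 + 12) + 2 = (2 * (n + 12) + 2 + 1) + 1 := by ring
    rw [e, Nat.factorial_succ, Nat.factorial_succ, pow_succ]
    have h2 : 2 ≤ (2 * (n + 12) + 2 + 1 + 1) * (2 * (n + 12) + 2 + 1) := by
      have h1 : 1 ≤ 2 * (n + 12) + 2 + 1 := by omega
      calc 2 ≤ 2 * (n + 12) + 2 + 1 + 1 := by omega
        _ = (2 * (n + 12) + 2 + 1 + 1) * 1 := by ring
        _ ≤ (2 * (n + 12) + 2 + 1 + 1) * (2 * (n + 12) + 2 + 1) := Nat.mul_le_mul_left _ h1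
    calc Nat.factorial 26 * (2 ^ n * 2) = (Nat.factorial 26 * 2 ^ n) * 2 := by ring
      _ ≤ Nat.factorial (2 * (n + 12) + 2) * 2 := Nat.mul_le_mul_right _ ih
      _ = 2 * Nat.factorial (2 * (n + 12) + 2) := by ring
      _ ≤ ((2 * (n + 12) + 2 + 1 + 1) * (2 * (n + 12) + 2 + 1)) * Nat.factorial (2 * (n + 12) + 2) :=
          Nat.mul_le_mul_right _ h2
      _ = (2 * (n + 12) + 2 + 1 + 1) * ((2 * (n + 12) + 2 + 1) * Nat.factorial (2 * (n + 12) + 2)) := by ring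

/-- Geometric tail bound: `g ρ s (m+12) ≤ (ρ²⁴/26!)·(1/2)^m`. -/
theorem tail_le {ρ s : ℝ} (hρ0 : 0 ≤ ρ) (hρ1 : ρ ≤ 1) (hs0 : 0 ≤ s) (m : ℕ) :
    g ρ s (m + 12) ≤ ρ ^ 24 / (Nat.factorial 26 : ℝ) * (1 / 2) ^ m := by
  have hF : (Nat.factorial 26 : ℝ) * 2 ^ m ≤ ((2 * (m + 12) + 2).factorial : ℝ) := by
    exact_mod_cast fact_ge m
  calc g ρ s (m + 12) ≤ c ρ (m + 12) := g_le_c hρ0 hs0 _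
    _ = ρ ^ (2 * m) * ρ ^ 24 / ((2 * (m + 12) + 2).factorial : ℝ) := by
        unfold c; rw [show 2 * (m + 12) = 2 * m + 24 by ring, pow_add]
    _ ≤ 1 * ρ ^ 24 / ((2 * (m + 12) + 2).factorial : ℝ) := by
        gcongr; exact pow_le_one₀ hρ0 hρ1
    _ ≤ ρ ^ 24 / ((Nat.factorial 26 : ℝ) * 2 ^ m) := by
        rw [one_mul]; exact div_le_div_of_nonneg_left (by positivity) (by positivity) hF
    _ = ρ ^ 24 / (Nat.factorial 26 : ℝ) * (1 / 2) ^ m := by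
        rw [one_div, inv_pow]; field_simp

/-- Two-sided truncation bound: `S ≤ hf ≤ S + 2ρ²⁴/26!` with `S` the 12-term partial sum. -/
theorem hf_bounds {ρ s : ℝ} (hρ0 : 0 < ρ) (hρ1 : ρ ≤ 1) (hs0 : 0 ≤ s) (hs1 : s ≤ 1) :
    (∑ m ∈ range 12, g ρ s m) ≤ hf ρ s ∧
      hf ρ s ≤ (∑ m ∈ range 12, g ρ s m) + ρ ^ 24 / (Nat.factorial 26 : ℝ) * 2 := by
  have H := hasSum_g hρ0.ne' s
  have Ht := (hasSum_nat_add_iff' 12).mpr H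
  have Hg : HasSum (fun m : ℕ => ρ ^ 24 / (Nat.factorial 26 : ℝ) * ((1:ℝ) / 2) ^ m)
      (ρ ^ 24 / (Nat.factorial 26 : ℝ) * 2) := hasSum_geometric_two.mul_left _
  have up := hasSum_le (fun m => tail_le hρ0.le hρ1 hs0 m) Ht Hg
  have lo := hasSum_le (fun m => g_nonneg hρ0.le hs0 hs1 (m + 12)) (hasSum_zero) Ht
  constructor <;> linarith

/-- Exact integration of the squared truncated polynomial. -/
theorem integral_sq_poly (K : ℝ) (cf : ℕ → ℝ) (N : ℕ) :
    ∫ s in (0:ℝ)..1, (K - ∑ m ∈ range N, cf m * s ^ (2 * m + 2)) ^ 2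
      = K ^ 2 - 2 * K * ∑ m ∈ range N, cf m / (2 * m + 3)
        + ∑ m ∈ range N, ∑ n ∈ range N, cf m * cf n / (2 * m + 2 * n + 5) := by
  have expand : ∀ s : ℝ, (K - ∑ m ∈ range N, cf m * s ^ (2 * m + 2)) ^ 2
      = K ^ 2 - 2 * K * (∑ m ∈ range N, cf m * s ^ (2 * m + 2))
        + ∑ m ∈ range N, ∑ n ∈ range N, cf m * cf n * s ^ (2 * m + 2 * n + 4) := by
    intro s
    rw [sub_sq, sq (∑ m ∈ range N, cf m * s ^ (2 * m + 2)), Finset.sum_mul_sum]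
    congr 1
    refine Finset.sum_congr rfl (fun m _ => Finset.sum_congr rfl (fun n _ => ?_))
    rw [show 2 * m + 2 * n + 4 = (2 * m + 2) + (2 * n + 2) by ring, pow_add]; ring
  simp_rw [expand]
  have iB : ∀ m ∈ range N, IntervalIntegrable (fun s : ℝ => cf m * s ^ (2 * m + 2)) volume 0 1 :=
    fun m _ => (by fun_prop : Continuous fun s : ℝ => cf m * s ^ (2 * m + 2)).intervalIntegrable 0 1
  have iBB : ∀ m ∈ range N, IntervalIntegrable
      (fun s : ℝ => ∑ n ∈ range N, cf m * cf n * s ^ (2 * m + 2 * n + 4)) volume 0 1 :=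
    fun m _ => (continuous_finsetSum _ (fun n _ => by fun_prop)).intervalIntegrable 0 1
  have hB : ∫ s in (0:ℝ)..1, (∑ m ∈ range N, cf m * s ^ (2 * m + 2))
      = ∑ m ∈ range N, cf m / (2 * m + 3) := by
    rw [intervalIntegral.integral_finsetSum iB]
    refine Finset.sum_congr rfl (fun m _ => ?_)
    rw [intervalIntegral.integral_const_mul, integral_pow]
    push_cast
    simp; ring
  have hBB : ∫ s in (0:ℝ)..1, (∑ m ∈ range N, ∑ n ∈ range N, cf m * cf n * s ^ (2 * m + 2 * n + 4))
      = ∑ m ∈ range N, ∑ n ∈ range N, cf m * cf n / (2 * m + 2 * n + 5) := by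
    rw [intervalIntegral.integral_finsetSum iBB]
    refine Finset.sum_congr rfl (fun m _ => ?_)
    rw [intervalIntegral.integral_finsetSum (fun n _ => (by fun_prop :
      Continuous fun s : ℝ => cf m * cf n * s ^ (2 * m + 2 * n + 4)).intervalIntegrable 0 1)]
    refine Finset.sum_congr rfl (fun n _ => ?_)
    rw [intervalIntegral.integral_const_mul, integral_pow]
    push_cast
    simp; ring
  have iK : IntervalIntegrable (fun _ : ℝ => K ^ 2) volume 0 1 := intervalIntegrable_const
  have iKB : IntervalIntegrable (fun s : ℝ => 2 * K * ∑ m ∈ range N, cf m * s ^ (2 * m + 2)) volume 0 1 :=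
    ((continuous_finsetSum _ (fun m _ => by fun_prop)).const_mul _ |>.intervalIntegrable 0 1)
  have iS : IntervalIntegrable
      (fun s : ℝ => ∑ m ∈ range N, ∑ n ∈ range N, cf m * cf n * s ^ (2 * m + 2 * n + 4)) volume 0 1 :=
    (continuous_finsetSum _ (fun m _ => continuous_finsetSum _ (fun n _ => by fun_prop))).intervalIntegrable 0 1
  rw [intervalIntegral.integral_add (iK.sub iKB) iS, intervalIntegral.integral_sub iK iKB,
    intervalIntegral.integral_const_mul, hB, hBB, intervalIntegral.integral_const]
  simp

/-- `PH` as the truncated double sum plus the tail allowance `8ρ²⁴/26!` (polynomial identity). -/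
theorem PH_eq (ρ : ℝ) :
    PH ρ = (∑ m ∈ range 12, c ρ m) ^ 2 - 2 * (∑ m ∈ range 12, c ρ m) * (∑ m ∈ range 12, c ρ m / (2 * m + 3))
      + (∑ m ∈ range 12, ∑ n ∈ range 12, c ρ m * c ρ n / (2 * m + 2 * n + 5))
      + 8 * ρ ^ 24 / (Nat.factorial 26 : ℝ) := by
  simp only [PH, evenPoly, PHc, List.foldr, c, Finset.sum_range_succ, Finset.sum_range_zero]
  norm_num [Nat.factorial_succ]
  ring

/-- Stage E, first half: the majorant of record for `‖H_ρ‖²` holds on `[0,1]`. -/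
theorem majorH : MajorH := by
  intro ρ hρ0 hρ1
  rcases hρ0.eq_or_lt with h0 | hpos
  · -- ρ = 0
    subst h0
    have : HnormSq 0 = 0 := by simp [HnormSq]
    rw [this]
    norm_num [PH, evenPoly, PHc]
  -- 0 < ρ ≤ 1
  set A := ∑ m ∈ range 12, c ρ m with hA
  set B1 := ∑ m ∈ range 12, c ρ m / (2 * m + 3) with hB1
  set B2 := ∑ m ∈ range 12, ∑ n ∈ range 12, c ρ m * c ρ n / (2 * m + 2 * n + 5) with hB2
  set t := ρ ^ 24 / (Nat.factorial 26 : ℝ) * 2 with ht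
  -- pointwise square bound
  have hpt : ∀ s ∈ Icc (0:ℝ) 1, (hf ρ s) ^ 2 ≤ ((A + t) - ∑ m ∈ range 12, c ρ m * s ^ (2 * m + 2)) ^ 2 := by
    intro s hs
    obtain ⟨lo, up⟩ := hf_bounds hpos hρ1 hs.1 hs.2
    have hS : (∑ m ∈ range 12, g ρ s m) = A - ∑ m ∈ range 12, c ρ m * s ^ (2 * m + 2) := by
      rw [hA, ← Finset.sum_sub_distrib]
      refine Finset.sum_congr rfl (fun m _ => ?_)
      unfold g; ring
    have hSnn : 0 ≤ ∑ m ∈ range 12, g ρ s m := Finset.sum_nonneg (fun m _ => g_nonneg hpos.le hs.1 hs.2 m)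
    have h0 : 0 ≤ hf ρ s := le_trans hSnn lo
    have h1 : hf ρ s ≤ (A + t) - ∑ m ∈ range 12, c ρ m * s ^ (2 * m + 2) := by rw [hS] at up; linarith
    exact pow_le_pow_left₀ h0 h1 2
  -- integrate
  have hint : HnormSq ρ ≤ ∫ s in (0:ℝ)..1, ((A + t) - ∑ m ∈ range 12, c ρ m * s ^ (2 * m + 2)) ^ 2 := by
    unfold HnormSq
    refine intervalIntegral.integral_mono_on zero_le_one ?_ ?_ (fun s hs => hpt s hs)
    · exact (by fun_prop : Continuous fun s : ℝ => ((Real.cosh ρ - Real.cosh (ρ * s)) / ρ ^ 2) ^ 2).intervalIntegrable 0 1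
    · exact ((continuous_const.sub (continuous_finsetSum _ (fun m _ => by fun_prop))).pow 2).intervalIntegrable 0 1
  rw [integral_sq_poly] at hint
  -- the algebra
  have key := PH_eq ρ
  have hAle : A ≤ 1 := by
    calc A ≤ ∑ m ∈ range 12, 1 / ((2 * m + 2).factorial : ℝ) := Finset.sum_le_sum (fun m _ => c_le hpos.le hρ1 m)
      _ ≤ 1 := by norm_num [Finset.sum_range_succ, Nat.factorial_succ]
  have hB1nn : 0 ≤ B1 := Finset.sum_nonneg (fun m _ => by
    have := c_nonneg hpos.le m
    positivity)
  have ht0 : 0 ≤ t := by positivity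
  have ht1 : t ≤ 1 := by
    rw [ht]
    have : ρ ^ 24 ≤ 1 := pow_le_one₀ hpos.le hρ1
    have h26 : (2:ℝ) ≤ (Nat.factorial 26 : ℝ) := by norm_num [Nat.factorial_succ]
    rw [div_mul_eq_mul_div, div_le_one (by positivity)]
    linarith
  have hfin : (A + t) ^ 2 - 2 * (A + t) * B1 + B2 ≤ PH ρ := by
    rw [key]
    have e8 : 8 * ρ ^ 24 / (Nat.factorial 26 : ℝ) = 4 * t := by rw [ht]; ring
    rw [e8]
    nlinarith [mul_nonneg ht0 hB1nn, mul_le_mul_of_nonneg_left hAle ht0, mul_le_mul_of_nonneg_left ht1 ht0]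
  rw [← hB1, ← hB2] at hint
  exact le_trans hint hfin

end MH

end Summit.NavierStokesRegularity.TurbBounds.FSU1.Mode
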